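import Literature.NumberTheory.LFunctions.SonineCompletedMellinEntire
import Literature.NumberTheory.LFunctions.BurnolFourierZetaSonine
import Literature.Analysis.DeBrangesSpaces.BurnolCosineKernelClosedForm
import Literature.Analysis.Fourier.L2FourierReflection
import Literature.Analysis.Fourier.L2FourierConj
import Literature.Analysis.FunctionSpaces.PlancherelL1L2
import Literature.Analysis.SpecialFunctions.GammaProductBounds
import HarnessLib

/-!
# The functional equation `M(𝓕₊ f)(s) = M(f)(1 − s)` of the completed Mellin transform on the Sonine
# spaces `K_a`, and the DISCHARGE of Burnol 2004 (Forum Math.) Prop. 6.7 (`Burnol2004_prop_6_7`)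

LINE 1 — LABEL: RH-FREE (unconditional theorems of analysis about even `L²` functions vanishing on `(−a,a)`
together with their Fourier transform; the zeros of `ζ` do not occur). FRAMING (cell rh-crit, D-0074):
corpus theorems are RH-FREE literature; nothing here is worded as progress toward RH. bears_on: B-C/B-P
(LADDER-RH COLUMN 6, de Branges framework): this is the Fourier symmetry `M(𝓕₊f)(s) = M(f)(1−s)` behind
the evaluators `Z^λ_{w,k}` of Burnol's Sonine spaces (`BurnolFourierZetaSonine.lean`, `BurnolZetaSystems.lean`).
WHAT THIS IS NOT: not a route, not a criterion for RH, no positivity statement; discharging a 1964 theorem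
of de Branges fixes the vocabulary of a corpus, it does not move RH. Nothing here bears on the truth of RH.

Sources. J.-F. Burnol, *Sur certains espaces de Hilbert de fonctions entières, liés à la transformation
de Fourier et aux fonctions L de Dirichlet et de Riemann*, C. R. Acad. Sci. Paris Sér. I 333 (2001)
201–206 = arXiv:math/0105120 [Burnol2001CRAS] (TeX of record
`rh-crit/dbl/src/Burnol2001CRAS_arXivmath0105120.tex`), §1: eq. (1.1) `f̂(s) = γ₊(s)(𝓕₊f)^(1−s)`
(TeX l.279–281), eq. (1.3) `C_a(u,w) = γ₊(w)u^{−w} − 2∫_0^a cos(2πut)t^{w−1}dt` and its proof by Fubini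
with `D_a(u,w) = 2∫_0^a cos(2πut)t^{w−1}dt` (TeX l.328–339); J.-F. Burnol, *Two complete and minimal
systems associated with the zeros of the Riemann zeta function*, J. Théor. Nombres Bordeaux 16 (2004)
65–94 = arXiv:math/0203120v7 [Burnol2004b], Thm. 2.1 (de Branges 1964: `M(f)` entire, TeX l.437–443)
and Prop. 2.2 ("One has the functional equations `M(𝓕₊(f))(s) = M(f)(1−s)`", TeX l.459–468);
J.-F. Burnol, *On Fourier and Zeta(s)*, Forum Math. 16 (2004) 789–840 = arXiv:math/0112254 [Burnol2004],
Thm. 6.3 (TeX l.2313–2325) and Prop. 6.7 "`𝓕₊(Z^λ_{w,k}) = (−1)^k Z^λ_{1−w,k}`" with its proof "from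
`M(𝓕₊(f))(w) = M(f)(1−w)`" (TeX l.2372–2380).

## What is proved (no definitions, no new named facts)

§A (namespace `Literature.Analysis.DeBrangesSpaces.SonineMellin`, continuing `SonineMellinEntire.lean`
and `BurnolCosineKernelEntire.lean`; `K_a` in the symmetric form `S(a,a)` of Connes–Consani: a.e. even,
zero a.e. on `[−a,a]`, `𝓕 f` zero a.e. on `[−a,a]`):
* `fourierIntegral_hw`: `𝓕(|x|^{w−1}𝟙_{|x|<a})(u) = D_a(u,w) = 2∫_0^a cos(2πut)t^{w−1}dt` (`Re w > 0`);
* `cosKernel_eq_closedForm`: eq. (1.3) for the entire kernel of record `cosKernel a u` (`u > 0`, `Re w > 0`),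
  from dbl-t2's Lemme 1.3 `IsBurnolC.eq_closedForm`;
* `integral_fourier_mul_D_eq_zero`: `∫_a^∞ 𝓕f(u)D_a(u,w)du = 0` for `f ∈ K_a`, `Re w > 1/2`;
* `sonineMellinExt_eq_gammaPlus_mul` — **eq. (1.1) continued**: `G_{𝓕f}(w) = γ₊(w)G_f(1−w)` for
  `Re w > 1/2`, `G_g = sonineMellinExt a a (𝓕 g)` the entire continuation of `∫_0^∞ g(t)t^{w−1}dt`.

§B (namespace `Literature.NumberTheory.LFunctions`):
* `exists_hasCompletedMellinEntire`: for `f ∈ K_a` an entire `M` with `M(s) = Γ_ℝ(s)f̂(s)` on the strip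
  exists (`= Γ_ℝ(s)G_{𝓕f}(1−s)` off the poles of `Γ_ℝ`; the poles are cancelled by the trivial zeros, the
  zeros of `1/Γ_ℝ` being simple: `deriv_Gammaℝ_inv_ne_zero`);
* `completedMellinEntire_fourier_eq` — **the functional equation** `M(𝓕 f) = M(f)(1 − ·)` for the
  canonical entire completed Mellin transforms `completedMellinEntire` (`BurnolSonineZeros.lean`);
* `Burnol2004_prop_6_7_holds : Burnol2004_prop_6_7` — DISCHARGE, via gm-t12's landed reduction
  `Burnol2004_prop_6_7_of_functionalEquation`.

Deviation from the printed road (said once): Burnol obtains (1.1) a.e. on the critical line from the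
Mellin–Plancherel diagonalisation of `Γ₊ = 𝓕₊I` and continues analytically; here (1.1) is proved directly on
`Re w > 1/2` for `f ∈ K_a` by reading the printed proof of (1.3) backwards — `G_{𝓕f}(w) = ∫_a^∞ 𝓕f·C_a(·,w)`
(eq. (1.2), `SonineMellinEntire.lean`), `C_a = γ₊u^{−w} − D_a` (eq. (1.3), dbl-t2), and the `D`-term
vanishes by the `L²` multiplication formula — so no Mellin–Plancherel theory is needed; the strip
identity then propagates to `ℂ` by the identity theorem built into `HasCompletedMellinEntire.eq`.
-/

noncomputable section

open _root_.MeasureTheory _root_.Complex _root_.Filter _root_.Set FourierTransform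
open scoped Topology Real ComplexConjugate ENNReal
open Literature.NumberTheory.ConnesConsani2021 (soninSpace)
open Literature.Analysis.DeBrangesSpaces.Burnol2001

/-! ## §A. Eq. (1.1) continued on `K_a`: `G_{𝓕f}(w) = γ₊(w)·G_f(1 − w)` for `Re w > 1/2` -/

namespace Literature.Analysis.DeBrangesSpaces.SonineMellin

/-! ### `L²` plumbing (private copies of the plumbing of `SonineMellinEntire.lean`) -/

/-- `|e^{iλt}| = 1`. [folklore] -/
private theorem norm_cexp_I_mul' (l t : ℝ) : ‖cexp (I * l * t)‖ = 1 := by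
  rw [show (I * l * t : ℂ) = ((l * t : ℝ) : ℂ) * I by push_cast; ring]
  exact Complex.norm_exp_ofReal_mul_I _

/-- `∫_ℝ h = ∫_0^∞ (h(v) + h(−v)) dv`. [folklore] -/
private theorem integral_eq_integral_Ioi_add_neg {h : ℝ → ℂ} (hh : Integrable h) :
    ∫ x, h x = ∫ x in Ioi 0, (h x + h (-x)) := by
  have h1 : IntegrableOn h (Iic 0) := hh.integrableOn
  have h2 : IntegrableOn h (Ioi 0) := hh.integrableOn
  have h3 : IntegrableOn (fun x ↦ h (-x)) (Ioi 0) := hh.comp_neg.integrableOn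
  rw [← intervalIntegral.integral_Iic_add_Ioi h1 h2, integral_add h2 h3, add_comm]
  congr 1
  rw [integral_comp_neg_Ioi]; simp

/-- Pull-back of an a.e. property along `x ↦ −x`. [folklore] -/
private theorem ae_comp_neg {p : ℝ → Prop} (h : ∀ᵐ x : ℝ, p x) : ∀ᵐ x : ℝ, p (-x) :=
  (Measure.measurePreserving_neg (volume : Measure ℝ)).quasiMeasurePreserving.ae h

/-- For an integrable even `h` vanishing a.e. on `[−a,a]`: `∫_ℝ h = 2∫_a^∞ h`. [folklore] -/
private theorem integral_eq_two_mul_integral_Ioi {h : ℝ → ℂ} (hh : Integrable h)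
    (heven : ∀ᵐ x : ℝ, h (-x) = h x) {b : ℝ} (hb : 0 ≤ b)
    (hzero : ∀ᵐ x : ℝ, x ∈ Icc (-b) b → h x = 0) :
    ∫ x, h x = 2 * ∫ x in Ioi b, h x := by
  rw [integral_eq_integral_Ioi_add_neg hh]
  have e1 : ∫ x in Ioi 0, (h x + h (-x)) = ∫ x in Ioi 0, 2 * h x := by
    refine integral_congr_ae ?_
    filter_upwards [ae_restrict_of_ae (s := Ioi 0) heven] with x hx
    rw [hx]; ring
  rw [e1, integral_const_mul]
  congr 1
  have hI : IntegrableOn h (Ioi 0) := hh.integrableOn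
  rw [← Ioc_union_Ioi_eq_Ioi hb, setIntegral_union (Set.Ioc_disjoint_Ioi le_rfl) measurableSet_Ioi
    (hI.mono_set Ioc_subset_Ioi_self) (hI.mono_set (Ioi_subset_Ioi hb))]
  have e2 : ∫ x in Ioc 0 b, h x = 0 := by
    refine integral_eq_zero_of_ae ?_
    filter_upwards [ae_restrict_mem measurableSet_Ioc, ae_restrict_of_ae (s := Ioc 0 b) hzero]
      with x hx hz
    exact hz ⟨by linarith [hx.1], hx.2⟩
  rw [e2, zero_add]

/-- The `L²` multiplication formula `∫ (𝓕φ)ψ = ∫ φ(𝓕ψ)` (from `Lp.inner_fourier_eq` and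
`𝓕(conj ψ) = conj(𝓕⁻ψ)`). [cite: Champeney1987, Thm. 6.1 (p. 54)] -/
private theorem integral_fourier_mul_eq (φ ψ : Lp ℂ 2 (volume : Measure ℝ)) :
    ∫ x, ((𝓕 φ : Lp ℂ 2 (volume : Measure ℝ)) : ℝ → ℂ) x * (ψ : ℝ → ℂ) x =
      ∫ x, (φ : ℝ → ℂ) x * ((𝓕 ψ : Lp ℂ 2 (volume : Measure ℝ)) : ℝ → ℂ) x := by
  set J := ((starₗᵢ ℂ : ℂ ≃ₗᵢ⋆[ℂ] ℂ).toContinuousLinearEquiv : ℂ →L⋆[ℂ] ℂ).compLpL 2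
    (volume : Measure ℝ) with hJ
  set v : Lp ℂ 2 (volume : Measure ℝ) := J φ with hv
  have hvcoe : (v : ℝ → ℂ) =ᵐ[volume] fun x ↦ conj ((φ : ℝ → ℂ) x) :=
    Literature.Analysis.Fourier.coeFn_conjLp φ
  have h1 := Literature.Analysis.Fourier.fourierInv_conj_ae_eq hvcoe
  have e1 : inner ℂ (𝓕⁻ v : Lp ℂ 2 (volume : Measure ℝ)) ψ =
      ∫ x, ((𝓕 φ : Lp ℂ 2 (volume : Measure ℝ)) : ℝ → ℂ) x * (ψ : ℝ → ℂ) x := by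
    rw [L2.inner_def]
    refine integral_congr_ae ?_
    filter_upwards [h1] with x hx
    simp only [RCLike.inner_apply']
    rw [hx, Complex.conj_conj]
  have e2 : inner ℂ (𝓕⁻ v : Lp ℂ 2 (volume : Measure ℝ)) ψ =
      ∫ x, (φ : ℝ → ℂ) x * ((𝓕 ψ : Lp ℂ 2 (volume : Measure ℝ)) : ℝ → ℂ) x := by
    rw [← Lp.inner_fourier_eq, fourier_fourierInv_eq, L2.inner_def]
    refine integral_congr_ae ?_
    filter_upwards [hvcoe] with x hx
    simp only [RCLike.inner_apply']
    rw [hx, Complex.conj_conj]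
  rw [← e1, e2]

/-- `𝓕𝓕F = F` for an a.e.-even `F ∈ L²(ℝ)` (`𝓕⁻ = 𝓕` on even classes). [folklore] -/
private theorem fourier_fourier_of_even {F : Lp ℂ 2 (volume : Measure ℝ)}
    (hF : ∀ᵐ x : ℝ, (F : ℝ → ℂ) (-x) = (F : ℝ → ℂ) x) :
    (𝓕 (𝓕 F : Lp ℂ 2 (volume : Measure ℝ)) : Lp ℂ 2 (volume : Measure ℝ)) = F := by
  rw [Literature.Analysis.Fourier.fourier_fourier_eq_compNeg]
  apply Lp.ext
  filter_upwards [Literature.Analysis.Fourier.coeFn_compNeg F, hF] with x h1 h2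
  rw [h1, h2]

/-- The `L²` Fourier transform of an a.e.-even class is a.e. even. [folklore] -/
private theorem fourier_even {f : Lp ℂ 2 (volume : Measure ℝ)}
    (hf : ∀ᵐ x : ℝ, (f : ℝ → ℂ) (-x) = (f : ℝ → ℂ) x) :
    ∀ᵐ x : ℝ, ((𝓕 f : Lp ℂ 2 (volume : Measure ℝ)) : ℝ → ℂ) (-x) =
      ((𝓕 f : Lp ℂ 2 (volume : Measure ℝ)) : ℝ → ℂ) x := by
  have h1 : Lp.compMeasurePreserving (fun x : ℝ ↦ -x) (Measure.measurePreserving_neg (volume : Measure ℝ))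
      f = f := by
    apply Lp.ext
    filter_upwards [Literature.Analysis.Fourier.coeFn_compNeg f, hf] with x h1 h2
    rw [h1, h2]
  have h2 := Literature.Analysis.Fourier.fourier_compNeg f
  rw [h1] at h2
  have h3 := Literature.Analysis.Fourier.coeFn_compNeg (𝓕 f : Lp ℂ 2 (volume : Measure ℝ))
  rw [← h2] at h3
  filter_upwards [h3] with x hx
  exact hx.symm

/-! ### the test function `h_w(x) = |x|^{w-1} 𝟙_{|x|<a}` -/

/-- `h_w` is even. [folklore] -/
private theorem hw_neg (a : ℝ) (w : ℂ) (x : ℝ) :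
    (Set.indicator {x : ℝ | |x| < a} (fun x : ℝ ↦ ((|x| : ℝ) : ℂ) ^ (w - 1))) (-x) =
      (Set.indicator {x : ℝ | |x| < a} (fun x : ℝ ↦ ((|x| : ℝ) : ℂ) ^ (w - 1))) x := by
  simp [Set.indicator, abs_neg]

/-- On `x > 0`, `h_w(x) = x^{w−1}𝟙_{(0,a)}(x)`. [folklore] -/
private theorem hw_eq_indicator_of_pos (a : ℝ) (w : ℂ) {x : ℝ} (hx : 0 < x) :
    (Set.indicator {x : ℝ | |x| < a} (fun x : ℝ ↦ ((|x| : ℝ) : ℂ) ^ (w - 1))) x =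
      Set.indicator (Ioo 0 a) (fun x : ℝ ↦ (x : ℂ) ^ (w - 1)) x := by
  simp [Set.indicator, abs_of_pos hx, hx]

/-- `h_w` is measurable. [folklore] -/
private theorem measurable_hw (a : ℝ) (w : ℂ) :
    Measurable (Set.indicator {x : ℝ | |x| < a} (fun x : ℝ ↦ ((|x| : ℝ) : ℂ) ^ (w - 1))) := by
  refine Measurable.indicator ?_ (isOpen_lt continuous_abs continuous_const).measurableSet
  exact (Complex.measurable_ofReal.comp continuous_abs.measurable).pow_const _

/-- `h_w` is integrable on `(0,∞)` for `Re w > 0`. [folklore] -/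
private theorem integrableOn_hw_Ioi {a : ℝ} (ha : 0 < a) {w : ℂ} (hw : 0 < w.re) :
    IntegrableOn (Set.indicator {x : ℝ | |x| < a} (fun x : ℝ ↦ ((|x| : ℝ) : ℂ) ^ (w - 1))) (Ioi 0) := by
  have h1 : IntegrableOn (fun x : ℝ ↦ (x : ℂ) ^ (w - 1)) (Ioo 0 a) :=
    (intervalIntegral.integrableOn_Ioo_cpow_iff ha).mpr (by simp; linarith)
  have h2 : IntegrableOn (Set.indicator (Ioo 0 a) (fun x : ℝ ↦ (x : ℂ) ^ (w - 1))) (Ioi 0) :=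
    (h1.integrable_indicator measurableSet_Ioo).integrableOn
  exact h2.congr_fun (fun x hx ↦ (hw_eq_indicator_of_pos a w hx).symm) measurableSet_Ioi

/-- `h_w ∈ L¹(ℝ)` for `Re w > 0`. [folklore] -/
private theorem integrable_hw {a : ℝ} (ha : 0 < a) {w : ℂ} (hw : 0 < w.re) :
    Integrable (Set.indicator {x : ℝ | |x| < a} (fun x : ℝ ↦ ((|x| : ℝ) : ℂ) ^ (w - 1))) := by
  have heven := hw_neg a w
  have h1 : IntegrableOn (Set.indicator {x : ℝ | |x| < a} (fun x : ℝ ↦ ((|x| : ℝ) : ℂ) ^ (w - 1)))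
      (Ici 0) := (integrableOn_Ici_iff_integrableOn_Ioi).mpr (integrableOn_hw_Ioi ha hw)
  have h2 : IntegrableOn (Set.indicator {x : ℝ | |x| < a} (fun x : ℝ ↦ ((|x| : ℝ) : ℂ) ^ (w - 1)))
      (Iic 0) := by
    have hmp := Measure.measurePreserving_neg (volume : Measure ℝ)
    have hme : MeasurableEmbedding (fun x : ℝ ↦ -x) := (Homeomorph.neg ℝ).measurableEmbedding
    have := (hmp.integrableOn_comp_preimage hme
      (f := Set.indicator {x : ℝ | |x| < a} (fun x : ℝ ↦ ((|x| : ℝ) : ℂ) ^ (w - 1))) (s := Ici 0)).mpr h1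
    have hpre : (fun x : ℝ ↦ -x) ⁻¹' (Ici 0) = Iic 0 := by ext x; simp
    rw [hpre] at this
    refine this.congr_fun (fun x _ ↦ ?_) measurableSet_Iic
    simp only [Function.comp_apply, heven]
  have := h2.union (integrableOn_hw_Ioi ha hw)
  rwa [Iic_union_Ioi, integrableOn_univ] at this

/-- `h_w ∈ L²(ℝ)` for `Re w > 1/2`. [folklore] -/
private theorem memLp_hw {a : ℝ} (ha : 0 < a) {w : ℂ} (hw : 1 / 2 < w.re) :
    MemLp (Set.indicator {x : ℝ | |x| < a} (fun x : ℝ ↦ ((|x| : ℝ) : ℂ) ^ (w - 1))) 2 volume := by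
  rw [memLp_two_iff_integrable_sq_norm (measurable_hw a w).aestronglyMeasurable]
  set N : ℝ → ℝ := fun x ↦ ‖(Set.indicator {x : ℝ | |x| < a}
    (fun x : ℝ ↦ ((|x| : ℝ) : ℂ) ^ (w - 1))) x‖ ^ 2 with hN
  have hNeven : ∀ x, N (-x) = N x := by intro x; simp [hN, hw_neg]
  have h1 : IntegrableOn (fun x : ℝ ↦ x ^ (2 * (w.re - 1))) (Ioo 0 a) := by
    rw [← intervalIntegrable_iff_integrableOn_Ioo_of_le ha.le]
    exact intervalIntegral.intervalIntegrable_rpow' (by linarith)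
  have h2 : IntegrableOn N (Ioi 0) := by
    have h3 : IntegrableOn (Set.indicator (Ioo 0 a) (fun x : ℝ ↦ x ^ (2 * (w.re - 1)))) (Ioi 0) :=
      (h1.integrable_indicator measurableSet_Ioo).integrableOn
    refine h3.congr_fun (fun x hx ↦ ?_) measurableSet_Ioi
    rw [hN]; simp only
    rw [hw_eq_indicator_of_pos a w hx]
    by_cases hxa : x < a
    · have hxm : x ∈ Ioo 0 a := ⟨hx, hxa⟩
      rw [Set.indicator_of_mem hxm, Set.indicator_of_mem hxm,
        norm_cpow_eq_rpow_re_of_pos hx, ← Real.rpow_natCast, ← Real.rpow_mul hx.le]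
      congr 1; simp; ring
    · have hxm : x ∉ Ioo 0 a := fun h ↦ hxa h.2
      rw [Set.indicator_of_notMem hxm, Set.indicator_of_notMem hxm]
      simp
  have h4 : IntegrableOn N (Ici 0) := (integrableOn_Ici_iff_integrableOn_Ioi).mpr h2
  have h5 : IntegrableOn N (Iic 0) := by
    have hmp := Measure.measurePreserving_neg (volume : Measure ℝ)
    have hme : MeasurableEmbedding (fun x : ℝ ↦ -x) := (Homeomorph.neg ℝ).measurableEmbedding
    have := (hmp.integrableOn_comp_preimage hme (f := N) (s := Ici 0)).mpr h4
    have hpre : (fun x : ℝ ↦ -x) ⁻¹' (Ici 0) = Iic 0 := by ext x; simp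
    rw [hpre] at this
    refine this.congr_fun (fun x _ ↦ ?_) measurableSet_Iic
    simp only [Function.comp_apply, hNeven]
  have := h5.union h2
  rwa [Iic_union_Ioi, integrableOn_univ] at this

/-- **The Fourier integral of `h_w(x) = |x|^{w-1}𝟙_{|x|<a}` is Burnol's `D_a(u,w) = 2∫_0^a cos(2πut)t^{w-1}dt`**
(`Re w > 0`): "Soit `D_a(u,w) = 2∫_0^a cos(2πut)t^{w−1}dt` (pour `Re(w) > 0`.) Par Fubini on a
`∫_0^a 𝓕₊(f)(t)t^{w−1}dt = ∫_0^∞ D_a(u,w)f(u)du`". [cite: Burnol2001CRAS, §1, proof of eq. (1.3) (TeX l.331–335)] -/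
theorem fourierIntegral_hw {a : ℝ} (ha : 0 < a) {w : ℂ} (hw : 0 < w.re) (u : ℝ) :
    𝓕 (Set.indicator {x : ℝ | |x| < a} (fun x : ℝ ↦ ((|x| : ℝ) : ℂ) ^ (w - 1))) u =
      2 * ∫ t in Ioc 0 a, ((Real.cos (2 * π * u * t) : ℝ) : ℂ) * (t : ℂ) ^ (w - 1) := by
  rw [Real.fourier_real_eq_integral_exp_smul]
  simp only [smul_eq_mul]
  set h := Set.indicator {x : ℝ | |x| < a} (fun x : ℝ ↦ ((|x| : ℝ) : ℂ) ^ (w - 1)) with hh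
  set H : ℝ → ℂ := fun v ↦ cexp (↑(-2 * π * v * u) * I) * h v with hH
  have hHi : Integrable H := by
    refine (integrable_hw ha hw).bdd_mul (c := 1) (Continuous.aestronglyMeasurable (by fun_prop)) ?_
    refine Eventually.of_forall fun v ↦ ?_
    rw [show (↑(-2 * π * v * u) * I : ℂ) = I * ((-(2 * π * u) : ℝ) : ℂ) * v by push_cast; ring,
      norm_cexp_I_mul']
  rw [integral_eq_integral_Ioi_add_neg hHi]
  set ψ : ℝ → ℂ := fun v ↦ (2 * ((Real.cos (2 * π * u * v) : ℝ) : ℂ)) * (v : ℂ) ^ (w - 1) with hψ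
  have hEq : ∀ v ∈ Ioi (0 : ℝ), H v + H (-v) = Set.indicator (Ioo 0 a) ψ v := by
    intro v hv
    rw [hH]; simp only
    rw [hh, hw_neg, hw_eq_indicator_of_pos a w hv]
    by_cases hva : v < a
    · have hvm : v ∈ Ioo 0 a := ⟨hv, hva⟩
      rw [Set.indicator_of_mem hvm, Set.indicator_of_mem hvm, hψ]
      simp only
      rw [Complex.ofReal_cos, show ((2 * π * u * v : ℝ) : ℂ) = ((2 * π * u : ℝ) : ℂ) * (v : ℂ) by
        push_cast; ring, Complex.two_cos,
        show (↑(-2 * π * v * u) * I : ℂ) = -(((2 * π * u : ℝ) : ℂ) * v) * I by push_cast; ring,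
        show (↑(-2 * π * (-v) * u) * I : ℂ) = (((2 * π * u : ℝ) : ℂ) * v) * I by push_cast; ring]
      ring
    · have hvm : v ∉ Ioo 0 a := fun h' ↦ hva h'.2
      rw [Set.indicator_of_notMem hvm, Set.indicator_of_notMem hvm]
      simp
  rw [setIntegral_congr_fun measurableSet_Ioi hEq, setIntegral_indicator measurableSet_Ioo,
    show Ioi (0 : ℝ) ∩ Ioo 0 a = Ioo 0 a from by
      rw [Set.inter_eq_right]; exact Ioo_subset_Ioi_self,
    setIntegral_congr_set Ioo_ae_eq_Ioc, hψ]
  simp only [mul_assoc]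
  rw [integral_const_mul]

/-! ### The closed form of the kernel and the `D`-term -/

/-- The kernel of record `cosKernel a u` (the entire continuation of `C_a(u,·)` built in
`BurnolCosineKernelEntire.lean`) is an entire continuation of `C_a(u,·)` in the sense of `IsBurnolC`
(Lemme 1.2), for `u > 0`. [cite: Burnol2001CRAS, Lemme 1.2 (TeX l.355–358)] -/
theorem isBurnolC_cosKernel {a u : ℝ} (ha : 0 < a) (hu : 0 < u) : IsBurnolC a u (cosKernel a u) :=
  ⟨differentiable_cosKernel ha hu.ne', fun _ hw ↦ cosKernel_eq_burnolC ha hu.ne' hw⟩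

/-- **Eq. (1.3) for the kernel of record**: `C_a(u,w) = γ₊(w)u^{-w} − 2∫_0^a cos(2πut)t^{w−1}dt` for
`u > 0`, `Re w > 0` (dbl-t2's `IsBurnolC.eq_closedForm`, i.e. Lemme 1.3, applied to `cosKernel`).
[cite: Burnol2001CRAS, eq. (1.3) and Lemme 1.3 (TeX l.335–339, 359–364)] -/
theorem cosKernel_eq_closedForm {a u : ℝ} (ha : 0 < a) (hu : 0 < u) {w : ℂ} (hw : 0 < w.re) :
    cosKernel a u w = gammaPlus w * (u : ℂ) ^ (-w) -
      2 * ∫ t in Ioc 0 a, ((Real.cos (2 * π * u * t) : ℝ) : ℂ) * (t : ℂ) ^ (w - 1) :=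
  (isBurnolC_cosKernel ha hu).eq_closedForm ha hu hw

section Main

variable {a : ℝ} (ha : 0 < a) (f : Lp ℂ 2 (volume : Measure ℝ))
  (heven : ∀ᵐ x : ℝ, (f : ℝ → ℂ) (-x) = (f : ℝ → ℂ) x)
  (hfa : ∀ᵐ x : ℝ, x ∈ Icc (-a) a → (f : ℝ → ℂ) x = 0)
  (hFa : ∀ᵐ x : ℝ, x ∈ Icc (-a) a → ((𝓕 f : Lp ℂ 2 (volume : Measure ℝ)) : ℝ → ℂ) x = 0)

include ha heven hfa hFa in
/-- **The `D`-term vanishes on `K_a`**: for `f ∈ K_a = S(a,a)` and `Re w > 1/2`,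
`∫_a^∞ 𝓕f(u)·D_a(u,w)du = 0`. Printed: "Par Fubini on a `∫_0^a 𝓕₊(f)(t)t^{w−1}dt = ∫_0^∞ D_a(u,w)f(u)du`"
— here with the roles of `f` and `𝓕₊f = 𝓕f` exchanged (`𝓕𝓕f = f` for even `f`) and in `L²` form: `D_a(·,w)`
is the Fourier transform of `h_w = |x|^{w−1}𝟙_{|x|<a} ∈ L¹ ∩ L²` (`Re w > 1/2`), so by the multiplication
formula `∫ 𝓕f·𝓕h_w = ∫ 𝓕𝓕f·h_w = ∫ f·h_w = 0` since `f` vanishes on `(−a,a)`; `𝓕f` vanishes on `(−a,a)` and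
the integrand is even. [cite: Burnol2001CRAS, §1, proof of eq. (1.3) (TeX l.331–335)] -/
theorem integral_fourier_mul_D_eq_zero {w : ℂ} (hw : 1 / 2 < w.re) :
    ∫ u in Ioi a, ((𝓕 f : Lp ℂ 2 (volume : Measure ℝ)) : ℝ → ℂ) u *
      (2 * ∫ t in Ioc 0 a, ((Real.cos (2 * π * u * t) : ℝ) : ℂ) * (t : ℂ) ^ (w - 1)) = 0 := by
  set F : Lp ℂ 2 (volume : Measure ℝ) := 𝓕 f with hFdef
  have hFF : (𝓕 F : Lp ℂ 2 (volume : Measure ℝ)) = f := fourier_fourier_of_even heven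
  have hFeven : ∀ᵐ x : ℝ, (F : ℝ → ℂ) (-x) = (F : ℝ → ℂ) x := fourier_even heven
  have hw0 : 0 < w.re := by linarith
  have hh1 := integrable_hw ha hw0
  have hh2 := memLp_hw ha hw
  set h : Lp ℂ 2 (volume : Measure ℝ) := hh2.toLp _ with hhdef
  have hhcoe : (h : ℝ → ℂ) =ᵐ[volume]
      Set.indicator {x : ℝ | |x| < a} (fun x : ℝ ↦ ((|x| : ℝ) : ℂ) ^ (w - 1)) := hh2.coeFn_toLp
  have hFh : ((𝓕 h : Lp ℂ 2 (volume : Measure ℝ)) : ℝ → ℂ) =ᵐ[volume]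
      fun u ↦ 2 * ∫ t in Ioc 0 a, ((Real.cos (2 * π * u * t) : ℝ) : ℂ) * (t : ℂ) ^ (w - 1) := by
    filter_upwards [Literature.Analysis.FunctionSpaces.fourier_toLp_ae_eq_fourierIntegral hh1 hh2]
      with u hu
    rw [hu, fourierIntegral_hw ha hw0 u]
  set φ : ℝ → ℂ := fun u ↦ (F : ℝ → ℂ) u * ((𝓕 h : Lp ℂ 2 (volume : Measure ℝ)) : ℝ → ℂ) u with hφ
  have hφi : Integrable φ := (Lp.memLp F).integrable_mul (Lp.memLp _)
  have e1 : ∫ u in Ioi a, (F : ℝ → ℂ) u *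
      (2 * ∫ t in Ioc 0 a, ((Real.cos (2 * π * u * t) : ℝ) : ℂ) * (t : ℂ) ^ (w - 1)) =
      ∫ u in Ioi a, φ u := by
    refine integral_congr_ae ?_
    filter_upwards [ae_restrict_of_ae (s := Ioi a) hFh] with u hu
    rw [hφ]; simp only; rw [hu]
  have e2 : ∫ u, φ u = 2 * ∫ u in Ioi a, φ u := by
    refine integral_eq_two_mul_integral_Ioi hφi ?_ ha.le ?_
    · filter_upwards [hFeven, hFh, ae_comp_neg hFh] with x hx h1 h2
      rw [hφ]; simp only
      rw [hx, h1, h2]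
      congr 2
      refine setIntegral_congr_fun measurableSet_Ioc (fun t _ ↦ ?_)
      rw [show 2 * π * (-x) * t = -(2 * π * x * t) by ring, Real.cos_neg]
    · filter_upwards [hFa] with x hx hxI
      rw [hφ]; simp only
      rw [hx hxI, zero_mul]
  have e3 : ∫ u, φ u = 0 := by
    rw [hφ]
    simp only
    rw [← integral_fourier_mul_eq F h, hFF]
    refine integral_eq_zero_of_ae ?_
    filter_upwards [hhcoe, hfa] with x hx hz
    rw [hx, Pi.zero_apply]
    simp only [Set.indicator, mem_setOf_eq]
    split_ifs with hxa
    · rw [hz ⟨by linarith [(abs_lt.mp hxa).1], (abs_lt.mp hxa).2.le⟩, zero_mul]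
    · rw [mul_zero]
  have : ∫ u in Ioi a, φ u = 0 := by
    have h4 : (2 : ℂ) * ∫ u in Ioi a, φ u = 0 := by rw [← e2, e3]
    simpa using h4
  rw [e1, this]

include ha heven hfa hFa in
/-- **Eq. (1.1) continued, for `K_a`** ("presque partout sur la droite critique: `f̂(s) = γ₊(s)(𝓕₊f)^(1−s)`
(1.1) … et par (1.1) si `f ∈ K_{a,b}` alors `f̂(s)` existe en tant que fonction analytique dans `Re(s) > 1/2`"):
for `f ∈ K_a = S(a,a)` and `Re w > 1/2`, `G_{𝓕f}(w) = γ₊(w)·G_f(1 − w)`, where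
`G_g := sonineMellinExt a a (𝓕 g)` is the ENTIRE continuation of the left Mellin transform `∫_0^∞ g(t)t^{w−1}dt`
(`SonineMellinEntire.lean`; `𝓕𝓕f = f`). Proof as printed for (1.3), read backwards: expand the kernel
`C_a(u,w) = γ₊(w)u^{−w} − D_a(u,w)` (eq. (1.3)) under `G_{𝓕f}(w) = ∫_a^∞ 𝓕f(u)C_a(u,w)du`; the `D`-term
vanishes (`integral_fourier_mul_D_eq_zero`) and `∫_a^∞ 𝓕f(u)u^{−w}du = mellin (𝓕f) (1−w) = G_f(1−w)`
(`sonineMellinExt_eq_mellin`, `Re(1−w) < 1/2`). No Mellin–Plancherel theory is used.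
[cite: Burnol2001CRAS, eq. (1.1) and eq. (1.3) (TeX l.279–281, 288–291, 331–339)] -/
theorem sonineMellinExt_eq_gammaPlus_mul {w : ℂ} (hw : 1 / 2 < w.re) :
    sonineMellinExt a a ((𝓕 f : Lp ℂ 2 (volume : Measure ℝ)) : ℝ → ℂ) w =
      gammaPlus w * sonineMellinExt a a (f : ℝ → ℂ) (1 - w) := by
  set F : Lp ℂ 2 (volume : Measure ℝ) := 𝓕 f with hFdef
  have hFF : (𝓕 F : Lp ℂ 2 (volume : Measure ℝ)) = f := fourier_fourier_of_even heven
  have hFeven : ∀ᵐ x : ℝ, (F : ℝ → ℂ) (-x) = (F : ℝ → ℂ) x := fourier_even heven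
  have hFFa : ∀ᵐ x : ℝ, x ∈ Icc (-a) a → ((𝓕 F : Lp ℂ 2 (volume : Measure ℝ)) : ℝ → ℂ) x = 0 := by
    rw [hFF]; exact hfa
  have hw0 : 0 < w.re := by linarith
  -- Mellin of `F` at `1 - w` as an integral over `(a, ∞)` and as the continuation
  have hmelF : mellin (F : ℝ → ℂ) (1 - w) = ∫ u in Ioi a, (F : ℝ → ℂ) u * (u : ℂ) ^ (-w) := by
    rw [mellin]
    have hI : ∫ t : ℝ in Ioi 0, (t : ℂ) ^ (1 - w - 1) • (F : ℝ → ℂ) t =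
        ∫ t : ℝ in Ioi 0, Set.indicator (Ioi a) (fun t : ℝ ↦ (F : ℝ → ℂ) t * (t : ℂ) ^ (-w)) t := by
      refine integral_congr_ae ?_
      filter_upwards [ae_restrict_mem measurableSet_Ioi, ae_restrict_of_ae (s := Ioi 0) hFa]
        with x hx hz
      rw [show (1 : ℂ) - w - 1 = -w by ring]
      by_cases hxa : a < x
      · rw [Set.indicator_of_mem (show x ∈ Ioi a from hxa), smul_eq_mul, mul_comm]
      · have hx' : (0 : ℝ) < x := hx
        rw [Set.indicator_of_notMem (show x ∉ Ioi a from hxa), smul_eq_mul,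
          hz ⟨by linarith, le_of_not_gt hxa⟩, mul_zero]
    rw [hI, setIntegral_indicator measurableSet_Ioi,
      show Ioi (0 : ℝ) ∩ Ioi a = Ioi a from by rw [Set.inter_eq_right]; exact Ioi_subset_Ioi ha.le]
  have hcontF : sonineMellinExt a a ((𝓕 F : Lp ℂ 2 (volume : Measure ℝ)) : ℝ → ℂ) (1 - w) =
      mellin (F : ℝ → ℂ) (1 - w) :=
    sonineMellinExt_eq_mellin ha ha F hFeven hFa hFFa (by simp; linarith)
  rw [hFF] at hcontF
  -- integrability on `(a, ∞)` of the two pieces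
  have hint1 : IntegrableOn (fun u : ℝ ↦ (F : ℝ → ℂ) u * (u : ℂ) ^ (-w)) (Ioi a) := by
    have h1 : MemLp (fun u : ℝ ↦ (u : ℂ) ^ (-w)) 2 (volume.restrict (Ioi a)) := by
      have hc : ContinuousOn (fun u : ℝ ↦ (u : ℂ) ^ (-w)) (Ioi a) := fun u hu ↦
        (continuousAt_ofReal_cpow_const _ _ (Or.inr (ha.trans hu).ne')).continuousWithinAt
      rw [memLp_two_iff_integrable_sq_norm (hc.aestronglyMeasurable measurableSet_Ioi)]
      have h2 : IntegrableOn (fun u : ℝ ↦ u ^ (-2 * w.re)) (Ioi a) :=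
        integrableOn_Ioi_rpow_of_lt (by linarith) ha
      refine h2.congr_fun (fun u hu ↦ ?_) measurableSet_Ioi
      have hu0 : 0 < u := ha.trans hu
      rw [norm_cpow_eq_rpow_re_of_pos hu0, ← Real.rpow_natCast, ← Real.rpow_mul hu0.le]
      simp; ring
    exact ((Lp.memLp F).restrict _).integrable_mul h1
  have hD := integral_fourier_mul_D_eq_zero ha f heven hfa hFa hw
  -- expand the kernel by (1.3) on `(a, ∞)`
  have e1 : sonineMellinExt a a (F : ℝ → ℂ) w =
      ∫ u in Ioi a, (gammaPlus w * ((F : ℝ → ℂ) u * (u : ℂ) ^ (-w)) - (F : ℝ → ℂ) u *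
        (2 * ∫ t in Ioc 0 a, ((Real.cos (2 * π * u * t) : ℝ) : ℂ) * (t : ℂ) ^ (w - 1))) := by
    rw [sonineMellinExt]
    refine setIntegral_congr_fun measurableSet_Ioi (fun u hu ↦ ?_)
    rw [cosKernel_eq_closedForm ha (ha.trans hu) hw0]
    ring
  have hint2 : IntegrableOn (fun u : ℝ ↦ (F : ℝ → ℂ) u *
      (2 * ∫ t in Ioc 0 a, ((Real.cos (2 * π * u * t) : ℝ) : ℂ) * (t : ℂ) ^ (w - 1))) (Ioi a) := by
    -- it is `F · cosKernel` minus `γ₊ F u^{-w}`, both integrable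
    have h3 : IntegrableOn (fun u : ℝ ↦ (F : ℝ → ℂ) u * cosKernel a u w) (Ioi a) := by
      obtain ⟨K, hK0, hK⟩ := exists_bound_cosKernel ha ha ‖w‖
      have h1 : MemLp (fun u : ℝ ↦ cosKernel a u w) 2 (volume.restrict (Ioi a)) := by
        have hmeas : AEStronglyMeasurable (fun u : ℝ ↦ cosKernel a u w) (volume.restrict (Ioi a)) :=
          ((continuousOn_cosKernel ha w).mono fun u (hu : a < u) ↦ (ha.trans hu).ne').aestronglyMeasurable
            measurableSet_Ioi
        rw [memLp_two_iff_integrable_sq_norm hmeas]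
        have hint : IntegrableOn (fun u : ℝ ↦ K ^ 2 * u ^ (-2 : ℝ)) (Ioi a) :=
          (integrableOn_Ioi_rpow_of_lt (by norm_num) ha).const_mul _
        refine Integrable.mono' hint (hmeas.norm.pow 2) ?_
        filter_upwards [ae_restrict_mem measurableSet_Ioi] with u hu
        have hu0 : 0 < u := ha.trans hu
        have hb := hK u w (by rw [abs_of_pos hu0]; exact hu.le) le_rfl
        rw [Real.norm_eq_abs, abs_of_nonneg (by positivity)]
        calc ‖cosKernel a u w‖ ^ 2 ≤ (K / |u|) ^ 2 := pow_le_pow_left₀ (norm_nonneg _) hb 2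
          _ = K ^ 2 * u ^ (-2 : ℝ) := by
              rw [abs_of_pos hu0, div_pow, Real.rpow_neg hu0.le, Real.rpow_two, div_eq_mul_inv]
      exact ((Lp.memLp F).restrict _).integrable_mul h1
    have h5 : IntegrableOn (fun u : ℝ ↦ gammaPlus w * ((F : ℝ → ℂ) u * (u : ℂ) ^ (-w)) -
        (F : ℝ → ℂ) u * cosKernel a u w) (Ioi a) := (hint1.const_mul (gammaPlus w)).sub h3
    refine h5.congr_fun (fun u hu ↦ ?_) measurableSet_Ioi
    simp only
    rw [cosKernel_eq_closedForm ha (ha.trans hu) hw0]; ring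
  rw [e1, integral_sub (hint1.const_mul _) hint2, integral_const_mul, hD, sub_zero, ← hmelF, ← hcontF]

end Main

end Literature.Analysis.DeBrangesSpaces.SonineMellin

/-! ## §B. The entire completed Mellin transform, its functional equation, and Prop. 6.7 -/

namespace Literature.NumberTheory.LFunctions

open Literature.Analysis.DeBrangesSpaces.SonineMellin
open Literature.Analysis.SpecialFunctions (inv_Gamma_eq_prod_mul_inv_Gamma_add_nat)

/-! ### `1/Γ_ℝ` has simple zeros at `0, −2, −4, …` -/

/-- `(1/Γ)'(−n) = ∏_{k<n}(k − n)` (from `1/Γ(s) = (∏_{k≤n}(s+k))·1/Γ(s+n+1)`). [folklore] -/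
private theorem hasDerivAt_inv_Gamma_neg_nat (n : ℕ) :
    HasDerivAt (fun s : ℂ ↦ (Gamma s)⁻¹) (∏ k ∈ Finset.range n, ((k : ℂ) - n)) (-(n : ℂ)) := by
  have hfun : (fun s : ℂ ↦ (Gamma s)⁻¹) =
      fun s : ℂ ↦ ((∏ k ∈ Finset.range n, (s + (k : ℂ))) * (s + n)) * (Gamma (s + (n + 1)))⁻¹ := by
    funext s; rw [inv_Gamma_eq_prod_mul_inv_Gamma_add_nat s (n + 1), Finset.prod_range_succ, Nat.cast_succ]
  rw [hfun]
  -- derivative of the polynomial part at `-n`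
  have hQ : Differentiable ℂ (fun s : ℂ ↦ ∏ k ∈ Finset.range n, (s + (k : ℂ))) := by
    apply Differentiable.fun_finsetProd; intro k _; fun_prop
  have hQd := (hQ (-(n : ℂ))).hasDerivAt
  have hlin : HasDerivAt (fun s : ℂ ↦ s + n) 1 (-(n : ℂ)) := (hasDerivAt_id _).add_const _
  have hP : HasDerivAt (fun s : ℂ ↦ (∏ k ∈ Finset.range n, (s + (k : ℂ))) * (s + n))
      (∏ k ∈ Finset.range n, (-(n : ℂ) + k)) (-(n : ℂ)) := by
    refine (hQd.fun_mul hlin).congr_deriv ?_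
    rw [neg_add_cancel, mul_zero, zero_add, mul_one]
  -- derivative of `1/Γ(s + n + 1)` at `-n` exists (`Γ(1) ≠ 0`)
  have hG1 : DifferentiableAt ℂ (fun s : ℂ ↦ (Gamma (s + (n + 1)))⁻¹) (-(n : ℂ)) := by
    have h1 : DifferentiableAt ℂ Gamma ((fun s : ℂ ↦ s + (n + 1)) (-(n : ℂ))) := by
      apply Complex.differentiableAt_Gamma
      intro m hm
      have := congrArg Complex.re hm
      simp at this
      linarith
    have h2 : DifferentiableAt ℂ (fun s : ℂ ↦ Gamma (s + (n + 1))) (-(n : ℂ)) :=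
      DifferentiableAt.comp (-(n : ℂ)) h1 (differentiableAt_id.add_const _)
    refine h2.inv ?_
    rw [show (-(n : ℂ)) + (n + 1) = 1 by ring, Complex.Gamma_one]; exact one_ne_zero
  refine ((hP.fun_mul hG1.hasDerivAt).congr_deriv ?_)
  rw [show (-(n : ℂ)) + n = 0 by ring, mul_zero, zero_mul, add_zero,
    show (-(n : ℂ)) + (n + 1) = 1 by ring, Complex.Gamma_one, inv_one, mul_one]
  apply Finset.prod_congr rfl; intro k _; ring

/-- `∏_{k<n}(k − n) ≠ 0`. [folklore] -/
private theorem prod_range_sub_ne_zero (n : ℕ) : (∏ k ∈ Finset.range n, ((k : ℂ) - n)) ≠ 0 := by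
  rw [Finset.prod_ne_zero_iff]
  intro k hk
  rw [Finset.mem_range] at hk
  rw [sub_ne_zero]
  exact_mod_cast hk.ne

/-- `(1/Γ_ℝ)'(−2n) ≠ 0`: the zeros `0, −2, −4, …` of the entire function `1/Γ_ℝ` are simple. [folklore] -/
private theorem deriv_Gammaℝ_inv_ne_zero (n : ℕ) : deriv (fun s ↦ (Gammaℝ s)⁻¹) (-(2 * (n : ℂ))) ≠ 0 := by
  have hpi : (π : ℂ) ≠ 0 := ofReal_ne_zero.mpr Real.pi_pos.ne'
  -- `1/Γ_ℝ(s) = π^{s/2} · (Γ(s/2))⁻¹`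
  have hfun : (fun s ↦ (Gammaℝ s)⁻¹) = fun s ↦ (π : ℂ) ^ (s / 2) * (Gamma (s / 2))⁻¹ := by
    funext s
    rw [Gammaℝ_def, mul_inv, show -s / 2 = -(s / 2) by ring, cpow_neg, inv_inv]
  rw [hfun]
  have h1 : HasDerivAt (fun s : ℂ ↦ (π : ℂ) ^ (s / 2))
      ((π : ℂ) ^ ((-(2 * (n : ℂ))) / 2) * Complex.log π * (1 / 2)) (-(2 * (n : ℂ))) := by
    have := ((hasDerivAt_id (-(2 * (n : ℂ)))).div_const 2).const_cpow (c := (π : ℂ)) (Or.inl hpi)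
    simpa using this
  have h2 : HasDerivAt (fun s : ℂ ↦ (Gamma (s / 2))⁻¹)
      ((∏ k ∈ Finset.range n, ((k : ℂ) - n)) * (1 / 2)) (-(2 * (n : ℂ))) := by
    have hd := hasDerivAt_inv_Gamma_neg_nat n
    have hlin : HasDerivAt (fun s : ℂ ↦ s / 2) (1 / 2) (-(2 * (n : ℂ))) := by
      simpa using (hasDerivAt_id (-(2 * (n : ℂ)))).div_const 2
    rw [show (-(n : ℂ)) = (fun s : ℂ ↦ s / 2) (-(2 * (n : ℂ))) by simp only; ring] at hd
    exact HasDerivAt.comp (h₂ := fun s : ℂ ↦ (Gamma s)⁻¹) (h := fun s : ℂ ↦ s / 2)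
      (-(2 * (n : ℂ))) hd hlin
  have key : HasDerivAt (fun s : ℂ ↦ (π : ℂ) ^ (s / 2) * (Gamma (s / 2))⁻¹)
      ((π : ℂ) ^ ((-(2 * (n : ℂ))) / 2) * Complex.log π * (1 / 2) * (Gamma ((-(2 * (n : ℂ))) / 2))⁻¹ +
        (π : ℂ) ^ ((-(2 * (n : ℂ))) / 2) * ((∏ k ∈ Finset.range n, ((k : ℂ) - n)) * (1 / 2)))
      (-(2 * (n : ℂ))) := h1.fun_mul h2
  rw [key.deriv]
  have hG0 : (Gamma (-(2 * (n : ℂ)) / 2))⁻¹ = 0 := by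
    rw [show (-(2 * (n : ℂ))) / 2 = -(n : ℂ) by ring, Complex.Gamma_neg_nat_eq_zero, inv_zero]
  rw [hG0, mul_zero, zero_add]
  refine mul_ne_zero ?_ (mul_ne_zero (prod_range_sub_ne_zero n) (by norm_num))
  rw [Ne, cpow_eq_zero_iff, not_and_or]
  exact Or.inl hpi

/-! ### Removable singularities: `G/ψ` when the zeros of `ψ` are simple and kill `G` -/

/-- Removable singularities: if `G, ψ` are entire, every zero of `ψ` is simple and is a zero of `G`, then
`G/ψ` — completed at the zeros of `ψ` by `G'/ψ'` — is entire. [folklore] -/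
private theorem differentiable_div_removable {G ψ : ℂ → ℂ} (hG : Differentiable ℂ G)
    (hψ : Differentiable ℂ ψ) (hzero : ∀ s, ψ s = 0 → G s = 0)
    (hderiv : ∀ s, ψ s = 0 → deriv ψ s ≠ 0) :
    Differentiable ℂ (fun s ↦ if ψ s = 0 then deriv G s / deriv ψ s else G s / ψ s) := by
  intro s₀
  by_cases h0 : ψ s₀ = 0
  · -- at a (simple) zero of `ψ`: the function is `dslope G s₀ / dslope ψ s₀` near `s₀`
    have hdG : Differentiable ℂ (dslope G s₀) := fun s ↦
      ((Complex.differentiableOn_dslope (univ_mem : (univ : Set ℂ) ∈ 𝓝 s₀)).mpr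
        hG.differentiableOn s (mem_univ s)).differentiableAt univ_mem
    have hdψ : Differentiable ℂ (dslope ψ s₀) := fun s ↦
      ((Complex.differentiableOn_dslope (univ_mem : (univ : Set ℂ) ∈ 𝓝 s₀)).mpr
        hψ.differentiableOn s (mem_univ s)).differentiableAt univ_mem
    have hne : dslope ψ s₀ s₀ ≠ 0 := by rw [dslope_same]; exact hderiv s₀ h0
    have hev : ∀ᶠ s in 𝓝 s₀, dslope ψ s₀ s ≠ 0 := (hdψ s₀).continuousAt.eventually_ne hne
    have heq : (fun s ↦ if ψ s = 0 then deriv G s / deriv ψ s else G s / ψ s) =ᶠ[𝓝 s₀]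
        fun s ↦ dslope G s₀ s / dslope ψ s₀ s := by
      filter_upwards [hev] with s hs
      by_cases hss : s = s₀
      · subst hss; rw [if_pos h0, dslope_same, dslope_same]
      · have hψs : ψ s = (s - s₀) * dslope ψ s₀ s := by
          rw [← smul_eq_mul, sub_smul_dslope, h0, sub_zero]
        have hGs : G s = (s - s₀) * dslope G s₀ s := by
          rw [← smul_eq_mul, sub_smul_dslope, hzero s₀ h0, sub_zero]
        have hψne : ψ s ≠ 0 := by
          rw [hψs]; exact mul_ne_zero (sub_ne_zero.mpr hss) hs
        rw [if_neg hψne, hGs, hψs, mul_div_mul_left _ _ (sub_ne_zero.mpr hss)]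
    exact (((hdG s₀).div (hdψ s₀) hne).congr_of_eventuallyEq heq)
  · have hev : ∀ᶠ s in 𝓝 s₀, ψ s ≠ 0 := (hψ s₀).continuousAt.eventually_ne h0
    have heq : (fun s ↦ if ψ s = 0 then deriv G s / deriv ψ s else G s / ψ s) =ᶠ[𝓝 s₀]
        fun s ↦ G s / ψ s := by
      filter_upwards [hev] with s hs
      rw [if_neg hs]
    exact (((hG s₀).div (hψ s₀) h0).congr_of_eventuallyEq heq)

section Completed

variable {a : ℝ} (ha : 0 < a) (f : Lp ℂ 2 (volume : Measure ℝ))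
  (heven : ∀ᵐ x : ℝ, (f : ℝ → ℂ) (-x) = (f : ℝ → ℂ) x)
  (hfa : ∀ᵐ x : ℝ, x ∈ Icc (-a) a → (f : ℝ → ℂ) x = 0)
  (hFa : ∀ᵐ x : ℝ, x ∈ Icc (-a) a → ((𝓕 f : Lp ℂ 2 (volume : Measure ℝ)) : ℝ → ℂ) x = 0)

include ha heven hfa hFa in
/-- **The completed right Mellin transform `M(f)(s) = π^{−s/2}Γ(s/2)f̂(s)` of `f ∈ K_a` is an entire
function** (de Branges; Thm. 2.1 / Thm. 6.3 "The Mellin transforms of elements `f(t)` from `K_λ` are entire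
functions with trivial zeros at `s = −2n` … The entire functions `M(f)(s) = π^{−s/2}Γ(s/2)f̂(s)`"): there is
an entire `M` with `M(s) = Γ_ℝ(s)f̂(s)` on the strip `1/2 < Re s < 1` (`HasCompletedMellinEntire`), namely
`Γ_ℝ(s)·G(s)` off the poles of `Γ_ℝ`, `G(s) = sonineMellinExt a a (𝓕 f) (1 − s)` the entire continuation of
`f̂` (`Burnol2004b_thm2_1_holds`); the poles `s = −2n` of `Γ_ℝ` are cancelled by the trivial zeros
`G(−2n) = 0` (`sonineMellinExt_one_add_two_mul`), the zeros of `1/Γ_ℝ` being simple.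
[cite: Burnol2004b, Thm. 2.1 (arXiv:math/0203120v7 p. 5, TeX l.437–443); Burnol2004, Theorem 6.3 (TeX l.2313–2325)] -/
theorem exists_hasCompletedMellinEntire :
    ∃ M : ℂ → ℂ, HasCompletedMellinEntire (f : ℝ → ℂ) M ∧
      ∀ s, Gammaℝ s ≠ 0 →
        M s = Gammaℝ s * sonineMellinExt a a ((𝓕 f : Lp ℂ 2 (volume : Measure ℝ)) : ℝ → ℂ) (1 - s) := by
  set G : ℂ → ℂ := fun s ↦
    sonineMellinExt a a ((𝓕 f : Lp ℂ 2 (volume : Measure ℝ)) : ℝ → ℂ) (1 - s) with hGdef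
  set ψ : ℂ → ℂ := fun s ↦ (Gammaℝ s)⁻¹ with hψdef
  have hG : Differentiable ℂ G :=
    (differentiable_sonineMellinExt ha ha _).comp ((differentiable_const _).sub differentiable_id)
  have hψ : Differentiable ℂ ψ := differentiable_Gammaℝ_inv
  have hψzero : ∀ s, ψ s = 0 → ∃ n : ℕ, s = -(2 * n) := fun s hs ↦
    Gammaℝ_eq_zero_iff.mp (inv_eq_zero.mp hs)
  have hzero : ∀ s, ψ s = 0 → G s = 0 := by
    intro s hs
    obtain ⟨n, rfl⟩ := hψzero s hs
    simp only [hGdef]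
    rw [show (1 : ℂ) - -(2 * (n : ℂ)) = 1 + 2 * n by ring]
    exact sonineMellinExt_one_add_two_mul ha ha f heven hfa hFa n
  have hderiv : ∀ s, ψ s = 0 → deriv ψ s ≠ 0 := by
    intro s hs
    obtain ⟨n, rfl⟩ := hψzero s hs
    exact deriv_Gammaℝ_inv_ne_zero n
  refine ⟨fun s ↦ if ψ s = 0 then deriv G s / deriv ψ s else G s / ψ s,
    ⟨differentiable_div_removable hG hψ hzero hderiv, fun s h1 _ ↦ ?_⟩, fun s hs ↦ ?_⟩
  · have hne : ψ s ≠ 0 := inv_ne_zero (Gammaℝ_ne_zero_of_re_pos (by linarith))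
    show (if ψ s = 0 then deriv G s / deriv ψ s else G s / ψ s) = _
    rw [if_neg hne]
    simp only [hψdef, hGdef, div_inv_eq_mul]
    rw [sonineMellinExt_eq_mellin ha ha f heven hfa hFa (by simp; linarith), rightMellin, mul_comm]
  · have hne : ψ s ≠ 0 := inv_ne_zero hs
    show (if ψ s = 0 then deriv G s / deriv ψ s else G s / ψ s) = _
    rw [if_neg hne]
    simp only [hψdef, hGdef, div_inv_eq_mul]
    rw [mul_comm]

/-- `Γ_ℝ(1−s)·γ₊(s) = Γ_ℝ(s)` on the critical strip `0 < Re s < 1` (Mathlib's reflection formula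
`Gammaℝ_div_Gammaℝ_one_sub`: `Γ_ℝ(s)/Γ_ℝ(1−s) = Γ_ℂ(s)cos(πs/2)`, and `γ₊ = Γ_ℂ·cos(π·/2)`). [folklore] -/
private theorem Gammaℝ_one_sub_mul_gammaPlus {s : ℂ} (hs : 0 < s.re) (hs1 : s.re < 1) :
    Gammaℝ (1 - s) * gammaPlus s = Gammaℝ s := by
  have hs' : ∀ n : ℕ, s ≠ -(2 * n + 1) := by
    intro n hn
    have := congrArg Complex.re hn
    simp at this
    linarith
  have hG1 : Gammaℝ (1 - s) ≠ 0 := Gammaℝ_ne_zero_of_re_pos (by simp; linarith)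
  have h := Gammaℝ_div_Gammaℝ_one_sub hs'
  rw [div_eq_iff hG1] at h
  rw [h, gammaPlus, Gammaℂ_def]; ring

include ha heven hfa hFa in
/-- **The functional equation `M(𝓕₊(f))(s) = M(f)(1 − s)`** of the entire completed Mellin transforms
(`completedMellinEntire`, canonical by `HasCompletedMellinEntire.eq`) of `f ∈ K_a = S(a,a)` and of its
Fourier (cosine) transform (Thm. 6.3: "The entire functions `M(f)(s) = π^{−s/2}Γ(s/2)f̂(s)` satisfy the
functional equations `M(𝓕₊(f))(s) = M(f)(1−s)`"; Prop. 2.2: "One has the functional equations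
`M(𝓕₊(f))(s) = M(f)(1−s)`"). Proof: both sides are entire and agree on the strip `1/2 < Re s < 1` by
eq. (1.1) continued (`sonineMellinExt_eq_gammaPlus_mul`) and `Γ_ℝ(1−s)γ₊(s) = Γ_ℝ(s)` (Mathlib's
`Gammaℝ_div_Gammaℝ_one_sub`). [cite: Burnol2004, Theorem 6.3 (TeX l.2313–2325); Burnol2004b, Prop. 2.2 (arXiv:math/0203120v7 p. 5, TeX l.459–468); Burnol2001CRAS, eq. (1.1) (TeX l.279–281)] -/
theorem completedMellinEntire_fourier_eq :
    completedMellinEntire ((𝓕 f : Lp ℂ 2 (volume : Measure ℝ)) : ℝ → ℂ) =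
      fun s ↦ completedMellinEntire (f : ℝ → ℂ) (1 - s) := by
  set F : Lp ℂ 2 (volume : Measure ℝ) := 𝓕 f with hFdef
  have hFF : (𝓕 F : Lp ℂ 2 (volume : Measure ℝ)) = f := fourier_fourier_of_even heven
  have hFeven : ∀ᵐ x : ℝ, (F : ℝ → ℂ) (-x) = (F : ℝ → ℂ) x := fourier_even heven
  have hFFa : ∀ᵐ x : ℝ, x ∈ Icc (-a) a → ((𝓕 F : Lp ℂ 2 (volume : Measure ℝ)) : ℝ → ℂ) x = 0 := by
    rw [hFF]; exact hfa
  obtain ⟨M, hM, hMeq⟩ := exists_hasCompletedMellinEntire ha f heven hfa hFa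
  obtain ⟨MF, hMF, -⟩ := exists_hasCompletedMellinEntire ha F hFeven hFa hFFa
  have hcf : completedMellinEntire (f : ℝ → ℂ) = M :=
    (hasCompletedMellinEntire_completedMellinEntire ⟨M, hM⟩).eq hM
  have hcF : HasCompletedMellinEntire (F : ℝ → ℂ) (completedMellinEntire (F : ℝ → ℂ)) :=
    hasCompletedMellinEntire_completedMellinEntire ⟨MF, hMF⟩
  rw [hcf]
  refine hcF.eq ⟨hM.1.comp ((differentiable_const _).sub differentiable_id), fun s h1 h2 ↦ ?_⟩
  have hG1 : Gammaℝ (1 - s) ≠ 0 := Gammaℝ_ne_zero_of_re_pos (by simp; linarith)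
  have hsm : sonineMellinExt a a (f : ℝ → ℂ) (1 - s) = rightMellin (F : ℝ → ℂ) s := by
    rw [rightMellin, ← sonineMellinExt_eq_mellin ha ha F hFeven hFa hFFa (by simp; linarith), hFF]
  show M (1 - s) = Gammaℝ s * rightMellin (F : ℝ → ℂ) s
  rw [hMeq (1 - s) hG1, sub_sub_cancel, sonineMellinExt_eq_gammaPlus_mul ha f heven hfa hFa h1, hsm,
    ← mul_assoc, Gammaℝ_one_sub_mul_gammaPlus (by linarith) h2]

end Completed

/-- **Prop. 6.7 holds**: "One has `𝓕₊(Z^λ_{w,k}) = (−1)^k Z^λ_{1−w,k}`" — as typed (`Burnol2004_prop_6_7`: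
if `Z` is the evaluator of `K_λ` at `(w,k)` then `(−1)^k 𝓕 Z` is the evaluator at `(1−w,k)`), DISCHARGED
through gm-t12's reduction `Burnol2004_prop_6_7_of_functionalEquation` ("from `M(𝓕₊(f))(w) = M(f)(1−w)`")
and the functional equation `completedMellinEntire_fourier_eq` on every `K_λ = S(λ,λ)`
(`sonineK_eq_soninSpace`). [cite: Burnol2004, Proposition 6.7 (TeX l.2372–2380)] -/
theorem Burnol2004_prop_6_7_holds : Burnol2004_prop_6_7 :=
  Burnol2004_prop_6_7_of_functionalEquation fun lam hlam f hf ↦ by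
    rw [sonineK_eq_soninSpace] at hf
    obtain ⟨heven, hfa, hFa⟩ := hf
    exact completedMellinEntire_fourier_eq hlam f heven hfa hFa

/-! ### Corollaries in Burnol's one-sided vocabulary `sonineK a` (for the users of `BurnolZetaSystems.lean`,
`BurnolSonineZeros.lean`, `BurnolFourierZetaSonine.lean`) -/

/-- For `f ∈ K_a` (`sonineK a`), the canonical entire completed Mellin transform `𝒢_f = completedMellinEntire f`
HAS its defining property: it is entire and equals `Γ_ℝ(s)f̂(s)` on `1/2 < Re s < 1` (Thm. 2.1: "`M(f)(s) =
π^{−s/2}Γ(s/2)f̂(s)` is an entire function"). [cite: Burnol2004b, Thm. 2.1 (arXiv:math/0203120v7 p. 5, TeX l.437–443)] -/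
theorem hasCompletedMellinEntire_of_mem_sonineK {a : ℝ} (ha : 0 < a)
    {f : Lp ℂ 2 (volume : Measure ℝ)} (hf : f ∈ sonineK a) :
    HasCompletedMellinEntire (f : ℝ → ℂ) (completedMellinEntire (f : ℝ → ℂ)) := by
  rw [sonineK_eq_soninSpace] at hf
  obtain ⟨heven, hfa, hFa⟩ := hf
  obtain ⟨M, hM, -⟩ := exists_hasCompletedMellinEntire ha f heven hfa hFa
  exact hasCompletedMellinEntire_completedMellinEntire ⟨M, hM⟩

/-- For `f ∈ K_a` (`sonineK a`), off the poles `0, −2, −4, …` of `Γ_ℝ` the entire completed Mellin transform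
is EXPLICITLY `𝒢_f(s) = Γ_ℝ(s)·G(s)` with `G(s) = sonineMellinExt a a (𝓕 f) (1 − s)` the entire continuation of
`f̂` (Thm. 2.1 / Thm. 6.3: "`M(f)(s) = π^{−s/2}Γ(s/2)f̂(s)`").
[cite: Burnol2004b, Thm. 2.1 (arXiv:math/0203120v7 p. 5, TeX l.437–443); Burnol2004, Theorem 6.3 (TeX l.2313–2325)] -/
theorem completedMellinEntire_eq_Gammaℝ_mul_of_mem_sonineK {a : ℝ} (ha : 0 < a)
    {f : Lp ℂ 2 (volume : Measure ℝ)} (hf : f ∈ sonineK a) {s : ℂ} (hs : Gammaℝ s ≠ 0) :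
    completedMellinEntire (f : ℝ → ℂ) s =
      Gammaℝ s * sonineMellinExt a a ((𝓕 f : Lp ℂ 2 (volume : Measure ℝ)) : ℝ → ℂ) (1 - s) := by
  rw [sonineK_eq_soninSpace] at hf
  obtain ⟨heven, hfa, hFa⟩ := hf
  obtain ⟨M, hM, hMeq⟩ := exists_hasCompletedMellinEntire ha f heven hfa hFa
  rw [(hasCompletedMellinEntire_completedMellinEntire ⟨M, hM⟩).eq hM]
  exact hMeq s hs

/-- **The functional equation `𝒢_{𝓕f}(s) = 𝒢_f(1 − s)` on `K_a`** in Burnol's one-sided vocabulary `sonineK a`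
(Thm. 6.3: "`M(𝓕₊(f))(s) = M(f)(1−s)`"). [cite: Burnol2004, Theorem 6.3 (TeX l.2313–2325); Burnol2004b, Prop. 2.2 (arXiv:math/0203120v7 p. 5, TeX l.459–468)] -/
theorem completedMellinEntire_fourier_eq_of_mem_sonineK {a : ℝ} (ha : 0 < a)
    {f : Lp ℂ 2 (volume : Measure ℝ)} (hf : f ∈ sonineK a) :
    completedMellinEntire ((𝓕 f : Lp ℂ 2 (volume : Measure ℝ)) : ℝ → ℂ) =
      fun s ↦ completedMellinEntire (f : ℝ → ℂ) (1 - s) := by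
  rw [sonineK_eq_soninSpace] at hf
  obtain ⟨heven, hfa, hFa⟩ := hf
  exact completedMellinEntire_fourier_eq ha f heven hfa hFa

end Literature.NumberTheory.LFunctions
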